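import Summits.BirchSwinnertonDyer.BirchSwinnertonDyer.Theorems.ClassRecordThreeLambdaMatchingTransferAlgebra
import HarnessLib

/-!
# ROAD B12 ∕ B12′ «λ-MATCHING TRANSFER» — the transfer algebra from a RATIONAL anchor: the partner's IMC
# equality UP TO A POWER OF `p` (the printed rational clauses: Yan–Zhu 2026 Thm 5.7 (1) at `p = 3`,
# Burungale–Castella–Skinner 2025 Thm 1.2.4 (a) ∕ Thm 4.2.1 for weight-two newforms at `p ≥ 5`) together
# with the Euler-system-side divisibility UB for `E` itself (cell memo PROOF-BDP §55, `k = 0`) ALREADY give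
# the partner's INTEGRAL equality and hence INV (items 20262 ∕ 20263 @3; 19282 ∕ 19702 ∕ 19703 @p ≥ 5)

Cell `bsd-stepL` (run/shared/lean/pub/bsd-stepL/), seat `bsd-stepL-bdp` (prover g23, 2026-08-27). `--supports
stmt-BirchSwinnertonDyer-20262 --as helper`. THEOREMS ONLY; Theses-free; pure algebra in the X1 currency
FU(F, n) := «the first coefficient of `F ∈ R₀⟦T⟧` of norm 1 sits at index `n`» (= `μ(F) = 0 ∧ λ(F) = n`,
Washington Prop. 7.2), spelled out inline exactly as in the companion file
`ClassRecordThreeLambdaMatchingTransferAlgebra.lean` (bdp g17, p510403). Memo: HOME/proof/PROOF-BDP.md §57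
(this session; §37 mechanism, §37.11 algebraic side, §40 analytic side, §55 UB).

WHAT IS NEW RELATIVE TO p510403. There, `invariantsMatch_of_transfer` consumes the partner's anchor as an
INTEGRAL equality of ideals `(map g′) = (L′)` in `R₀⟦T⟧` — at `p = 3` the integral clause of Yan–Zhu 5.7 (1)
needs full `3`-adic image of the PARTNER (a mod-9 condition, port π4 of §40.4), and for a NON-RATIONAL partner
(the Ribet level-lowered newform `g` of level `N∕p`, ROAD B12′) only the RATIONAL clause is in print, so §37.13
had to book «μ(X_E) = 0» as a separate input. Here the anchor is consumed in its RATIONAL shape — the two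
divisibilities up to a power of `p`, verbatim the conjuncts of the tree facts
`YanZhu2026.thm57_isTorsion_charIdealXGr_eq_bdpLFunction` ∕
`BurungaleCastellaSkinner2025.thm124a_exists_isBDPLFunction_isTorsion_charIdeal_eq_rat` — and the missing
`μ`-information is supplied by the cell's own UB for `E` (`L ∈ (map g)`, PROOF-BDP §55, refereed g44–g54):
* `exists_firstUnitCoeffAt_of_mem_span_singleton` — if `L ∈ (G)` and `μ(L) = 0` (FU(L, n)) then `μ(G) = 0`
  (FU(G, b) for some `b ≤ n`): UB transports `μ = 0` from the BDP function to the Selmer side.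
* `span_singleton_eq_of_rational_anchor` — RATIONAL equality (`p^k L′ ∈ (G′)` and `p^{k′} G′ ∈ (L′)`) plus
  `μ(G′) = 0 = μ(L′)` give the INTEGRAL equality `(G′) = (L′)` (cancel the powers of `p` with X1's
  `exists_mul_eq_of_mul_eq_C_pow_mul` on both sides).
* **`invariantsMatch_of_transfer_rational`** — the B12′ composition: RATIONAL anchor for the partner ∧
  `μ(L′) = 0` (Hsieh 2014 Thm B ∕ BCS25 Prop 4.2.2) ∧ `μ = 0` for the two Σ-Euler factors ∧ the analytic
  congruence `u·L′·P′ ≡ L·P (mod 𝔪)` (§40) ∧ UB for `E` ∧ the residual `μ`-TRANSFER «`μ(map g·P) = 0 ⟹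
  μ(map g′·P′) = 0`» ∧ the residual `λ`-EQUALITY «both `μ = 0` ⟹ same index» (§37.11: `λ = s + d − c` is a
  `ρ̄`-invariant) ⟹ INV `∃ n, FU(map g, n) ∧ FU(L, n)` — verbatim the per-frame conjunct of
  `stub_inv3_invariantsMatch` ∕ hINV of p505319 ∕ p507771 — AND the partner's integral equality as a by-product.
  Order of deduction (the point of the file): μ(L′·P′) = 0 ⟹ (congruence) μ(L·P) = 0 ⟹ μ(L) = 0 ⟹ (UB)
  μ(map g) = 0 ⟹ (residual transfer) μ(map g′·P′) = 0 ⟹ μ(map g′) = 0 ⟹ (rational anchor) integral anchor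
  ⟹ p510403.

SCOPE NOTE: the partner's objects are typed in `R₀⟦T⟧` (`UnrSeries p`), i.e. this file covers rational partners
(`𝒪 = ℤ_p`) and newform partners whose prime `λ ∣ p` of the Hecke field is UNRAMIFIED (residue degree is 1
automatically when `ρ̄_g ≅ ρ̄_E`); a ramified `λ` needs the same algebra over `R₀[ϖ]⟦T⟧`.
-- TODO(general form): coefficient ring `R₀[ϖ]` for a ramified prime `λ` of the partner's Hecke field.

HONEST FRAMING: algebra only; none of the sources (anchor, `μ(L′) = 0`, congruence, UB, residual transfer) is
asserted here; nothing booked (T7); no item closes.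
References: [Washington1997] §7.1 Prop. 7.2; [GreenbergVatsal2000] §2, Prop. 2.4; [EmertonPollackWeston2006]
Thm. 1; [YanZhu2024MainConjNonCM] Thm. 5.7 (1); arXiv:2405.00270 Thm. 1.2.4 (a), Thm. 4.2.1, Prop. 4.2.2.
-/

set_option autoImplicit false
set_option linter.dupNamespace false

noncomputable section

open scoped Classical

open PowerSeries Literature.NumberTheory.EllipticCurves
  Summit.BirchSwinnertonDyer.Rank1Residual.X11b.Halves
  Summit.BirchSwinnertonDyer.Rank1Residual.X1.KellerYinHalves

namespace Summit.BirchSwinnertonDyer.BirchSwinnertonDyer.Theorems.LambdaMatching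

variable {p : ℕ} [Fact p.Prime]

/-! ### §1 UB transports `μ = 0` from `L` to the characteristic power series -/

/-- **`μ = 0` descends along a divisibility**: if `L ∈ (G)` in `R₀⟦T⟧` and `L` has a unit coefficient at index
`n` with smaller coefficients non-units (FU(L, n), i.e. `μ(L) = 0`, `λ(L) = n`), then `G` has its first unit
coefficient at some index `b ≤ n` (`μ(G) = 0`, `λ(G) ≤ λ(L)`). Proof: `L = Q·G`; if all coefficients of `G`
up to `n` were non-units, so would be the `n`-th coefficient of `Q·G`. [cite: Washington1997, §7.1 Prop. 7.2] -/
theorem exists_firstUnitCoeffAt_of_mem_span_singleton {G L : UnrSeries p} {n : ℕ}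
    (hmem : L ∈ Ideal.span ({G} : Set (UnrSeries p)))
    (hL : ‖((coeff n L : unrIntegers p) : ℂ_[p])‖ = 1 ∧
      ∀ i < n, ‖((coeff i L : unrIntegers p) : ℂ_[p])‖ < 1) :
    ∃ b ≤ n, (‖((coeff b G : unrIntegers p) : ℂ_[p])‖ = 1 ∧
      ∀ i < b, ‖((coeff i G : unrIntegers p) : ℂ_[p])‖ < 1) := by
  obtain ⟨Q, hQ⟩ := Ideal.mem_span_singleton'.mp hmem
  -- `hQ : Q * G = L`
  refine exists_firstUnitCoeffAt_of_exists_le ?_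
  by_contra hc
  push Not at hc
  have hlt := norm_coeff_mul_lt_one_of_forall_lt (F := Q) (G := G) (m := n) hc
  rw [hQ, hL.1] at hlt
  exact lt_irrefl _ hlt

/-! ### §2 RATIONAL anchor + `μ = 0` on both sides ⟹ INTEGRAL anchor -/

/-- **One divisibility, integrally**: if `p^k · L′ ∈ (G′)` and `G′` has a unit coefficient (`μ(G′) = 0`), then
`L′ ∈ (G′)` — the power of `p` cancels (X1's `exists_mul_eq_of_mul_eq_C_pow_mul`: `𝔽̄_p⟦T⟧` is a domain).
[cite: Washington1997, §7.1] -/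
theorem mem_span_singleton_of_C_pow_mul_mem {G' L' : UnrSeries p} {a k : ℕ}
    (hk : C ((p : unrIntegers p) ^ k) * L' ∈ Ideal.span ({G'} : Set (UnrSeries p)))
    (hG' : ‖((coeff a G' : unrIntegers p) : ℂ_[p])‖ = 1 ∧
      ∀ i < a, ‖((coeff i G' : unrIntegers p) : ℂ_[p])‖ < 1) :
    L' ∈ Ideal.span ({G'} : Set (UnrSeries p)) := by
  obtain ⟨A, hA⟩ := Ideal.mem_span_singleton'.mp hk
  -- `hA : A * G' = C (p ^ k) * L'`
  have hA₂ : G' * A = C ((p : unrIntegers p) ^ k) * L' := by rw [mul_comm]; exact hA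
  obtain ⟨A', hA'⟩ := exists_mul_eq_of_mul_eq_C_pow_mul (G := A) (L := L') hG' hA₂
  exact Ideal.mem_span_singleton'.mpr ⟨A', by rw [mul_comm]; exact hA'⟩

/-- **RATIONAL ⟹ INTEGRAL.** If `(G′) = (L′)` holds after inverting `p` — `p^k · L′ ∈ (G′)` and
`p^{k′} · G′ ∈ (L′)`, verbatim the rational clause of the printed anchors — and BOTH `G′` and `L′` have a unit
coefficient (`μ(G′) = 0`, `μ(L′) = 0`), then `(G′) = (L′)` in `R₀⟦T⟧`. [cite: Washington1997, §7.1 Prop. 7.2]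
[cite: YanZhu2024MainConjNonCM, Thm. 5.7 (1) (rational clause)] -/
theorem span_singleton_eq_of_rational_anchor {G' L' : UnrSeries p} {a b k k' : ℕ}
    (hk : C ((p : unrIntegers p) ^ k) * L' ∈ Ideal.span ({G'} : Set (UnrSeries p)))
    (hk' : C ((p : unrIntegers p) ^ k') * G' ∈ Ideal.span ({L'} : Set (UnrSeries p)))
    (hG' : ‖((coeff a G' : unrIntegers p) : ℂ_[p])‖ = 1 ∧
      ∀ i < a, ‖((coeff i G' : unrIntegers p) : ℂ_[p])‖ < 1)
    (hL' : ‖((coeff b L' : unrIntegers p) : ℂ_[p])‖ = 1 ∧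
      ∀ i < b, ‖((coeff i L' : unrIntegers p) : ℂ_[p])‖ < 1) :
    Ideal.span ({G'} : Set (UnrSeries p)) = Ideal.span {L'} := by
  refine le_antisymm ?_ ?_
  · exact (Ideal.span_singleton_le_iff_mem _).mpr (mem_span_singleton_of_C_pow_mul_mem hk' hL')
  · exact (Ideal.span_singleton_le_iff_mem _).mpr (mem_span_singleton_of_C_pow_mul_mem hk hG')

/-! ### §3 INV from a RATIONAL anchor + UB (ROAD B12′ composition) -/

/-- **ROAD B12′ — the invariants-match input from a RATIONAL anchor and UB.** Objects over ONE datum ∕ frame: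
`g, g′ ∈ Λ` generators of `Ch_Λ(X_E)`, `Ch_Λ(X_{partner})`; `L, L′ ∈ R₀⟦T⟧` the BDP frames; `P, P′` the products
of Σ-Euler factors; `u` a unit. Hypotheses (each a named source, none asserted): the partner's RATIONAL IMC
equality `p^k L′ ∈ (map g′) ∧ p^{k′} map g′ ∈ (L′)` (Yan–Zhu 5.7 (1) @3 ∕ BCS25 1.2.4 (a), 4.2.1 @p ≥ 5 — NO full-
image clause); `μ(L′) = 0` with `λ(L′) = n′` (Hsieh 2014 Thm. B ∕ BCS25 Prop. 4.2.2); `μ = 0` for both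
Σ-factors (split primes); the analytic congruence `u·L′·P′ ≡ L·P (mod 𝔪)` (PROOF-BDP §40); **UB for `E`**:
`L ∈ (map g)` (PROOF-BDP §55, `k = 0`); the residual `μ`-transfer `μ(map g·P) = 0 ⟹ μ(map g′·P′) = 0` and the
residual `λ`-equality (both `μ = 0 ⟹` same first-unit index) (PROOF-BDP §37.11: `λ(X^Σ) = s + d − c` and
finiteness of `Sel^Σ(K_∞, ρ̄)` are `ρ̄`-invariants). CONCLUSION: INV — a common index `n` with FU(map g, n) ∧
FU(L, n) (verbatim the per-frame conjunct of `stub_inv3_invariantsMatch` ∕ hINV of p505319, p507771) — AND the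
partner's INTEGRAL equality `(map g′) = (L′)`. Proof = the order of deduction in the module docstring, ending in
p510403's `invariantsMatch_of_transfer`. [cite: Washington1997, §7.1 Prop. 7.2]
[cite: EmertonPollackWeston2006, Thm. 1 (the mechanism)] [cite: GreenbergVatsal2000, Prop. 2.4 (same local factors on both sides)] -/
theorem invariantsMatch_of_transfer_rational {g g' : IwasawaAlgebra p} {L L' P P' u : UnrSeries p}
    {n' m m' k k' : ℕ}
    (hanc : C ((p : unrIntegers p) ^ k) * L' ∈
      Ideal.span ({PowerSeries.map (toUnr p) g'} : Set (UnrSeries p)))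
    (hanc' : C ((p : unrIntegers p) ^ k') * PowerSeries.map (toUnr p) g' ∈
      Ideal.span ({L'} : Set (UnrSeries p)))
    (hL' : ‖((coeff n' L' : unrIntegers p) : ℂ_[p])‖ = 1 ∧
      ∀ i < n', ‖((coeff i L' : unrIntegers p) : ℂ_[p])‖ < 1)
    (hP : ‖((coeff m P : unrIntegers p) : ℂ_[p])‖ = 1 ∧
      ∀ i < m, ‖((coeff i P : unrIntegers p) : ℂ_[p])‖ < 1)
    (hP' : ‖((coeff m' P' : unrIntegers p) : ℂ_[p])‖ = 1 ∧
      ∀ i < m', ‖((coeff i P' : unrIntegers p) : ℂ_[p])‖ < 1)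
    (hu : IsUnit u)
    (hcong : ∀ i, ‖((coeff i (u * (L' * P')) : unrIntegers p) : ℂ_[p]) -
      ((coeff i (L * P) : unrIntegers p) : ℂ_[p])‖ < 1)
    (hUB : L ∈ Ideal.span ({PowerSeries.map (toUnr p) g} : Set (UnrSeries p)))
    (hμ : (∃ a, ‖((coeff a (PowerSeries.map (toUnr p) g * P) : unrIntegers p) : ℂ_[p])‖ = 1 ∧
        ∀ i < a, ‖((coeff i (PowerSeries.map (toUnr p) g * P) : unrIntegers p) : ℂ_[p])‖ < 1) →
      ∃ a', ‖((coeff a' (PowerSeries.map (toUnr p) g' * P') : unrIntegers p) : ℂ_[p])‖ = 1 ∧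
        ∀ i < a', ‖((coeff i (PowerSeries.map (toUnr p) g' * P') : unrIntegers p) : ℂ_[p])‖ < 1)
    (hlam : ∀ a a',
      (‖((coeff a (PowerSeries.map (toUnr p) g * P) : unrIntegers p) : ℂ_[p])‖ = 1 ∧
        ∀ i < a, ‖((coeff i (PowerSeries.map (toUnr p) g * P) : unrIntegers p) : ℂ_[p])‖ < 1) →
      (‖((coeff a' (PowerSeries.map (toUnr p) g' * P') : unrIntegers p) : ℂ_[p])‖ = 1 ∧
        ∀ i < a', ‖((coeff i (PowerSeries.map (toUnr p) g' * P') : unrIntegers p) : ℂ_[p])‖ < 1) →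
      a = a') :
    (∃ n : ℕ, (‖((coeff n (PowerSeries.map (toUnr p) g) : unrIntegers p) : ℂ_[p])‖ = 1 ∧
        ∀ i < n, ‖((coeff i (PowerSeries.map (toUnr p) g) : unrIntegers p) : ℂ_[p])‖ < 1) ∧
      (‖((coeff n L : unrIntegers p) : ℂ_[p])‖ = 1 ∧
        ∀ i < n, ‖((coeff i L : unrIntegers p) : ℂ_[p])‖ < 1)) ∧
    Ideal.span ({PowerSeries.map (toUnr p) g'} : Set (UnrSeries p)) = Ideal.span {L'} := by
  -- (1) the analytic side: FU(L'·P', n'+m') ⟹ FU(u·L'·P', n'+m') ⟹ (congruence) FU(L·P, n'+m')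
  have hLP' := firstUnitCoeffAt_mul hL' hP'
  have huLP' := firstUnitCoeffAt_unit_mul hu hLP'
  have hLP : ‖((coeff (n' + m') (L * P) : unrIntegers p) : ℂ_[p])‖ = 1 ∧
      ∀ i < n' + m', ‖((coeff i (L * P) : unrIntegers p) : ℂ_[p])‖ < 1 :=
    firstUnitCoeffAt_of_congr hcong huLP'
  -- (2) divide out `P`: FU(L, c)
  have hPL : ‖((coeff (n' + m') (P * L) : unrIntegers p) : ℂ_[p])‖ = 1 ∧
      ∀ i < n' + m', ‖((coeff i (P * L) : unrIntegers p) : ℂ_[p])‖ < 1 := by rwa [mul_comm] at hLP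
  obtain ⟨c, hLc, -⟩ := exists_firstUnitCoeffAt_right hP hPL
  -- (3) UB: `L ∈ (map g)` ⟹ FU(map g, e)
  obtain ⟨e, -, hge⟩ := exists_firstUnitCoeffAt_of_mem_span_singleton hUB hLc
  -- (4) the Σ-imprimitive algebraic side of `E`: FU(map g · P, e + m)
  have hgP := firstUnitCoeffAt_mul hge hP
  -- (5) residual μ-transfer to the partner, then divide out `P'`: FU(map g', n'')
  obtain ⟨a', hg'P'⟩ := hμ ⟨e + m, hgP⟩
  have hP'g' : ‖((coeff a' (P' * PowerSeries.map (toUnr p) g') : unrIntegers p) : ℂ_[p])‖ = 1 ∧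
      ∀ i < a', ‖((coeff i (P' * PowerSeries.map (toUnr p) g') : unrIntegers p) : ℂ_[p])‖ < 1 := by
    rwa [mul_comm] at hg'P'
  obtain ⟨n'', hg'n'', -⟩ := exists_firstUnitCoeffAt_right hP' hP'g'
  -- (6) RATIONAL anchor + μ(map g') = 0 = μ(L') ⟹ INTEGRAL anchor
  have hint : Ideal.span ({PowerSeries.map (toUnr p) g'} : Set (UnrSeries p)) = Ideal.span {L'} :=
    span_singleton_eq_of_rational_anchor hanc hanc' hg'n'' hL'
  -- (7) residual λ-equality: the two Σ-imprimitive algebraic indices agree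
  have hidx : e + m = a' := hlam _ _ hgP hg'P'
  subst hidx
  -- (8) p510403
  exact ⟨invariantsMatch_of_transfer hint hL' hP hP' hu hcong hgP hg'P', hint⟩

/-- **Corollary (the shape p505319 ∕ p507771 consume, with UB returned alongside).** Under the hypotheses of
`invariantsMatch_of_transfer_rational`, BOTH binders of the λ-matching cuts hold at the frame: the Euler-side
divisibility in its `∃ k, p^k·L ∈ (map g)` form (with `k = 0`, from UB) and INV. [cite: Washington1997, §7.1 Prop. 7.2] -/
theorem ratUpperBound_and_invariantsMatch_of_transfer_rational {g g' : IwasawaAlgebra p}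
    {L L' P P' u : UnrSeries p} {n' m m' k k' : ℕ}
    (hanc : C ((p : unrIntegers p) ^ k) * L' ∈
      Ideal.span ({PowerSeries.map (toUnr p) g'} : Set (UnrSeries p)))
    (hanc' : C ((p : unrIntegers p) ^ k') * PowerSeries.map (toUnr p) g' ∈
      Ideal.span ({L'} : Set (UnrSeries p)))
    (hL' : ‖((coeff n' L' : unrIntegers p) : ℂ_[p])‖ = 1 ∧
      ∀ i < n', ‖((coeff i L' : unrIntegers p) : ℂ_[p])‖ < 1)
    (hP : ‖((coeff m P : unrIntegers p) : ℂ_[p])‖ = 1 ∧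
      ∀ i < m, ‖((coeff i P : unrIntegers p) : ℂ_[p])‖ < 1)
    (hP' : ‖((coeff m' P' : unrIntegers p) : ℂ_[p])‖ = 1 ∧
      ∀ i < m', ‖((coeff i P' : unrIntegers p) : ℂ_[p])‖ < 1)
    (hu : IsUnit u)
    (hcong : ∀ i, ‖((coeff i (u * (L' * P')) : unrIntegers p) : ℂ_[p]) -
      ((coeff i (L * P) : unrIntegers p) : ℂ_[p])‖ < 1)
    (hUB : L ∈ Ideal.span ({PowerSeries.map (toUnr p) g} : Set (UnrSeries p)))
    (hμ : (∃ a, ‖((coeff a (PowerSeries.map (toUnr p) g * P) : unrIntegers p) : ℂ_[p])‖ = 1 ∧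
        ∀ i < a, ‖((coeff i (PowerSeries.map (toUnr p) g * P) : unrIntegers p) : ℂ_[p])‖ < 1) →
      ∃ a', ‖((coeff a' (PowerSeries.map (toUnr p) g' * P') : unrIntegers p) : ℂ_[p])‖ = 1 ∧
        ∀ i < a', ‖((coeff i (PowerSeries.map (toUnr p) g' * P') : unrIntegers p) : ℂ_[p])‖ < 1)
    (hlam : ∀ a a',
      (‖((coeff a (PowerSeries.map (toUnr p) g * P) : unrIntegers p) : ℂ_[p])‖ = 1 ∧
        ∀ i < a, ‖((coeff i (PowerSeries.map (toUnr p) g * P) : unrIntegers p) : ℂ_[p])‖ < 1) →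
      (‖((coeff a' (PowerSeries.map (toUnr p) g' * P') : unrIntegers p) : ℂ_[p])‖ = 1 ∧
        ∀ i < a', ‖((coeff i (PowerSeries.map (toUnr p) g' * P') : unrIntegers p) : ℂ_[p])‖ < 1) →
      a = a') :
    (∃ k₀ : ℕ, C ((p : unrIntegers p) ^ k₀) * L ∈
        Ideal.span ({PowerSeries.map (toUnr p) g} : Set (UnrSeries p))) ∧
    (∃ n : ℕ, (‖((coeff n (PowerSeries.map (toUnr p) g) : unrIntegers p) : ℂ_[p])‖ = 1 ∧
        ∀ i < n, ‖((coeff i (PowerSeries.map (toUnr p) g) : unrIntegers p) : ℂ_[p])‖ < 1) ∧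
      (‖((coeff n L : unrIntegers p) : ℂ_[p])‖ = 1 ∧
        ∀ i < n, ‖((coeff i L : unrIntegers p) : ℂ_[p])‖ < 1)) :=
  ⟨⟨0, by rwa [pow_zero, map_one, one_mul]⟩,
    (invariantsMatch_of_transfer_rational hanc hanc' hL' hP hP' hu hcong hUB hμ hlam).1⟩

end Summit.BirchSwinnertonDyer.BirchSwinnertonDyer.Theorems.LambdaMatching

end
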